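import Mathlib.LinearAlgebra.Matrix.Block
import Literature.NumberTheory.GaloisRepresentations.LiftingObstructionContinuous
import HarnessLib

/-!
# Mazur's obstruction class for lifts into a parabolic (Borel) subgroup

Topic `Literature/NumberTheory/GaloisRepresentations`.  Continuation of `LiftingObstruction.lean`
and `LiftingObstructionContinuous.lean`: the same square-zero lifting calculus for
representations with values in a PARABOLIC subgroup `P_b ≤ GL_n` of block-upper-triangular
matrices (`Matrix.BlockTriangular · b` for a block pattern `b : n → α`; `b = id` on `Fin 2` is the
Borel subgroup of `GL₂`), which is the local deformation condition "nearly ordinary" /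
"ordinary with fixed filtration" at `v ∣ p`:

* `parabolicGL b R` — the subgroup `P_b(R) ≤ GL_n(R)`;
* `entryLift`, `liftMatrix`, `stdSection` — a set-theoretic lift `GL_n(A) → GL_n(B)` of `GL_n(φ)`
  for `φ : B ↠ A` with square-zero kernel which lifts `0` entries to `0`, hence maps `P_b(A)` into
  `P_b(B)` for EVERY pattern `b` (`stdSection_mem_parabolicGL`);
* `kerParabolic b φ = 𝔭_b(I)` — block-upper-triangular matrices with entries in `I = ker φ`
  (the Lie algebra of `P_b` tensored with `I`), and for a `P_b(A)`-valued `ρ` and a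
  `P_b`-compatible section `s`: the defect cocycle is `𝔭_b(I)`-valued (`liftDefect_mem_kerParabolic`)
  and **`ρ` lifts to a `P_b(B)`-valued homomorphism iff the defect is the coboundary of a
  `𝔭_b(I)`-valued cochain** (`exists_parabolic_lift_iff_exists_coboundary`) — B. Mazur,
  *Deforming Galois representations* (1989), §1.6 Prop. 2 and §1.7 (ordinary deformations);
  J. Tilouine, *Deformations of Galois representations and Hecke algebras* (1996), Ch. 6–7;
* the continuous version for a topological group `G` and `ρ` with open kernel: the continuous
  representation `adKerParabolicRep` of `G` on the discrete module `𝔭_b(I)` (conjugation through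
  `s ∘ ρ`), the class `parabolicObstructionClass ∈ H²_cont(G, 𝔭_b(I))` and
  **`parabolicObstructionClass_eq_zero_iff`: it vanishes iff `ρ` lifts to a `P_b(B)`-valued
  homomorphism with open kernel.**

This is the local ingredient (at `v ∣ p`, `P_b` = Borel) of the obstruction theory for nearly
ordinary deformation rings (Böckle 2007, Ex. 6.1 (a), Prop. 7.5: the local condition contributes
`H²(G_v, 𝔟_v)`).  Everything is proved; no named facts.

## References

* B. Mazur, *Deforming Galois representations*, in Galois groups over `ℚ`, MSRI Publ. 16
  (1989), §1.6 Prop. 2, §1.7. [cite: Mazur1989Deforming, §1.6 Prop. 2]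
* G. Böckle, *Presentations of universal deformation rings*, LMS LNS 320 (2007), Thm. 2.2,
  Ex. 6.1 (a), Prop. 7.5. [cite: Bockle2007Presentations, Theorem 2.2]
-/

noncomputable section

open Topology Filter

namespace Literature.NumberTheory.GaloisRepresentations

namespace LiftingObstruction

open Matrix

universe v

section Algebra

variable {n : Type*} [Fintype n] [DecidableEq n] {α : Type*} [LinearOrder α] (b : n → α)
  {A B : Type*} [CommRing A] [CommRing B]

/-! ## 1. Parabolic subgroups of `GL_n` -/

/-- The **parabolic subgroup** `P_b(R) ≤ GL_n(R)` of invertible block-upper-triangular matrices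
for the block pattern `b : n → α` (`g i j = 0` whenever `b j < b i`; the inverse of such a matrix
is again block-upper-triangular, Mathlib `blockTriangular_inv_of_blockTriangular`).  For
`b = id : Fin 2 → Fin 2` this is the Borel subgroup of upper-triangular matrices in `GL₂`.
[cite: Mazur1989Deforming, §1.7] -/
def parabolicGL (R : Type*) [CommRing R] : Subgroup (GL n R) where
  carrier := {g | (g : Matrix n n R).BlockTriangular b}
  one_mem' := by
    change ((1 : GL n R) : Matrix n n R).BlockTriangular b
    rw [Units.val_one]
    exact blockTriangular_one
  mul_mem' {g h} hg hh := by
    change ((g * h : GL n R) : Matrix n n R).BlockTriangular b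
    rw [Units.val_mul]
    exact hg.mul hh
  inv_mem' {g} hg := by
    change ((g⁻¹ : GL n R) : Matrix n n R).BlockTriangular b
    rw [Matrix.coe_units_inv]
    exact blockTriangular_inv_of_blockTriangular hg

variable {b} in
/-- Membership in `P_b(R)`. [folklore] -/
theorem mem_parabolicGL_iff {R : Type*} [CommRing R] (g : GL n R) :
    g ∈ parabolicGL b R ↔ (g : Matrix n n R).BlockTriangular b :=
  Iff.rfl

variable {b} in
/-- For `GL₂` and `b = id`, `P_b` is the Borel subgroup: `g ∈ P_id ↔ g₁₀ = 0`. [folklore] -/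
theorem mem_parabolicGL_id_fin_two_iff {R : Type*} [CommRing R] (g : GL (Fin 2) R) :
    g ∈ parabolicGL (id : Fin 2 → Fin 2) R ↔ (g : Matrix (Fin 2) (Fin 2) R) 1 0 = 0 := by
  rw [mem_parabolicGL_iff]
  constructor
  · intro h
    exact h (show (id 0 : Fin 2) < id 1 by decide)
  · intro h i j hij
    fin_cases i <;> fin_cases j <;> simp_all

variable {b} in
/-- `GL_n(φ)` maps `P_b(B)` into `P_b(A)`. [folklore] -/
theorem map_mem_parabolicGL (φ : B →+* A) {g : GL n B} (hg : g ∈ parabolicGL b B) :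
    Matrix.GeneralLinearGroup.map φ g ∈ parabolicGL b A := by
  rw [mem_parabolicGL_iff] at hg ⊢
  intro i j hij
  change φ ((g : Matrix n n B) i j) = 0
  rw [hg hij, map_zero]

/-! ## 2. A section of `GL_n(B) ↠ GL_n(A)` respecting all parabolics -/

variable {φ : B →+* A} (hφ : Function.Surjective φ)

open scoped Classical in
/-- A set-theoretic section of `φ : B ↠ A` sending `0` to `0`. [folklore] -/
def entryLift : ZeroHom A B where
  toFun a := if a = 0 then 0 else Function.surjInv hφ a
  map_zero' := if_pos rfl

/-- `entryLift` is a section of `φ`. [folklore] -/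
@[simp] theorem map_entryLift (a : A) : φ (entryLift hφ a) = a := by
  classical
  change φ (if a = 0 then 0 else Function.surjInv hφ a) = a
  split_ifs with h
  · rw [h, map_zero]
  · exact Function.surjInv_eq hφ a

/-- The entrywise lift of (the matrix of) `g ∈ GL_n(A)` to `M_n(B)`. [folklore] -/
def liftMatrix (g : GL n A) : Matrix n n B :=
  (g : Matrix n n A).map (entryLift hφ)

/-- `φ` applied entrywise to the lift gives back the original matrix. [folklore] -/
@[simp] theorem map_liftMatrix (g : GL n A) : (liftMatrix hφ g).map φ = g := by
  ext i j
  simp [liftMatrix]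

/-- `M_n(φ)` of the entrywise lift is the original matrix. [folklore] -/
@[simp] theorem mapMatrix_liftMatrix (g : GL n A) : φ.mapMatrix (liftMatrix hφ g) = g :=
  map_liftMatrix hφ g

/-- The entrywise lift of a block-upper-triangular matrix is block-upper-triangular. [folklore] -/
theorem blockTriangular_liftMatrix {g : GL n A} (hg : (g : Matrix n n A).BlockTriangular b) :
    (liftMatrix hφ g).BlockTriangular b :=
  hg.map (entryLift hφ)

variable (hI : ∀ x ∈ RingHom.ker φ, ∀ y ∈ RingHom.ker φ, x * y = 0)
include hI

/-- For `I² = 0` the entrywise lift of an invertible matrix is invertible (its determinant maps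
to a unit). [folklore] -/
theorem isUnit_liftMatrix (g : GL n A) : IsUnit (liftMatrix hφ g) := by
  rw [Matrix.isUnit_iff_isUnit_det]
  refine isUnit_of_isUnit_map hI hφ ?_
  rw [RingHom.map_det, mapMatrix_liftMatrix]
  exact (Matrix.isUnit_iff_isUnit_det _).mp (Units.isUnit g)

/-- **The standard section** `GL_n(A) → GL_n(B)` of `GL_n(φ)` (entrywise lift; `I² = 0`).
[cite: Mazur1989Deforming, §1.6 Prop. 2] -/
def stdSection (g : GL n A) : GL n B :=
  (isUnit_liftMatrix hφ hI g).unit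

/-- The matrix of `stdSection g` is the entrywise lift. [folklore] -/
@[simp] theorem coe_stdSection (g : GL n A) :
    (stdSection hφ hI g : Matrix n n B) = liftMatrix hφ g :=
  rfl

/-- `stdSection` is a section of `GL_n(φ)`. [folklore] -/
@[simp] theorem map_stdSection (g : GL n A) :
    Matrix.GeneralLinearGroup.map φ (stdSection hφ hI g) = g :=
  Units.ext (by simp [Matrix.GeneralLinearGroup.map])

/-- **`stdSection` maps `P_b(A)` into `P_b(B)`** for every block pattern `b` (it lifts zero
entries to zero). [cite: Mazur1989Deforming, §1.7] -/
theorem stdSection_mem_parabolicGL {g : GL n A} (hg : g ∈ parabolicGL b A) :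
    stdSection hφ hI g ∈ parabolicGL b B :=
  blockTriangular_liftMatrix b hφ hg

omit hI

/-! ## 3. The coefficients `𝔭_b(I)` and the parabolic defect -/

variable (φ) in
/-- `𝔭_b(I)`: block-upper-triangular matrices with entries in `I = ker φ` — the kernel of
`P_b(B) → P_b(A)` written additively (`Lie P_b ⊗ I`; for the Borel of `GL₂` this is `𝔟 ⊗ I`).
[cite: Mazur1989Deforming, §1.7] -/
def kerParabolic : AddSubgroup (Matrix n n B) where
  carrier := {X | X ∈ kerMatrix φ ∧ X.BlockTriangular b}
  zero_mem' := ⟨zero_mem _, blockTriangular_zero⟩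
  add_mem' := fun hX hY => ⟨add_mem hX.1 hY.1, hX.2.add hY.2⟩
  neg_mem' := fun hX => ⟨neg_mem hX.1, hX.2.neg⟩

/-- Membership in `𝔭_b(I)`. [folklore] -/
theorem mem_kerParabolic_iff (X : Matrix n n B) :
    X ∈ kerParabolic b φ ↔ X ∈ kerMatrix φ ∧ X.BlockTriangular b :=
  Iff.rfl

/-- `𝔭_b(I) ⊆ M_n(I)`. [folklore] -/
theorem kerParabolic_le_kerMatrix : kerParabolic b φ ≤ kerMatrix φ :=
  fun _ hX => hX.1

/-- An element of `P_b(B)` mapping to `1` is `1 + X` with `X ∈ 𝔭_b(I)`. [folklore] -/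
theorem val_sub_one_mem_kerParabolic (D : GL n B) (hD : D ∈ parabolicGL b B)
    (hD1 : Matrix.GeneralLinearGroup.map φ D = 1) :
    (D : Matrix n n B) - 1 ∈ kerParabolic b φ :=
  ⟨val_sub_one_mem D hD1, hD.sub blockTriangular_one⟩

/-- Conjugation by `P_b(B)` preserves `𝔭_b(I)`. [folklore] -/
theorem conj_mem_kerParabolic (P : GL n B) (hP : P ∈ parabolicGL b B) {X : Matrix n n B}
    (hX : X ∈ kerParabolic b φ) :
    (P : Matrix n n B) * X * ((P⁻¹ : GL n B) : Matrix n n B) ∈ kerParabolic b φ :=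
  ⟨mul_mem_kerMatrix_right _ (mul_mem_kerMatrix_left _ hX.1),
    (hP.mul hX.2).mul ((parabolicGL b B).inv_mem hP)⟩

variable {G : Type*} [Group G] {s : GL n A → GL n B}
  (hs : ∀ g, Matrix.GeneralLinearGroup.map φ (s g) = g)
  (hsP : ∀ g ∈ parabolicGL b A, s g ∈ parabolicGL b B)
  (ρ : G →* GL n A) (hρP : ∀ σ, ρ σ ∈ parabolicGL b A)

include hsP hρP in
/-- For a `P_b`-valued `ρ` and a `P_b`-compatible section, the defect lies in `P_b(B)`.
[cite: Mazur1989Deforming, §1.7] -/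
theorem defectUnit_mem_parabolicGL (σ τ : G) : defectUnit s ρ σ τ ∈ parabolicGL b B :=
  mul_mem (mul_mem (hsP _ (hρP σ)) (hsP _ (hρP τ))) (inv_mem (hsP _ (hρP (σ * τ))))

include hs hsP hρP in
/-- **The defect cocycle of a `P_b`-valued representation is `𝔭_b(I)`-valued.**
[cite: Mazur1989Deforming, §1.7] -/
theorem liftDefect_mem_kerParabolic (σ τ : G) : liftDefect s ρ σ τ ∈ kerParabolic b φ :=
  val_sub_one_mem_kerParabolic b _ (defectUnit_mem_parabolicGL b hsP ρ hρP σ τ)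
    (map_defectUnit hs ρ σ τ)

/-! ## 4. Mazur's criterion for `P_b`-valued lifts -/

include hsP hρP in
/-- The lift attached to a `𝔭_b(I)`-valued splitting cochain is `P_b(B)`-valued.
[cite: Mazur1989Deforming, §1.7] -/
theorem liftOfCoboundary_mem_parabolicGL
    (hI : ∀ x ∈ RingHom.ker φ, ∀ y ∈ RingHom.ker φ, x * y = 0)
    (c : G → Matrix n n B) (hc : ∀ σ, c σ ∈ kerParabolic b φ)
    (hcob : ∀ σ τ, liftDefect s ρ σ τ =
      (s (ρ σ) : Matrix n n B) * c τ * ((s (ρ σ))⁻¹ : GL n B) - c (σ * τ) + c σ) (σ : G) :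
    liftOfCoboundary hs hI ρ c (fun σ => (hc σ).1) hcob σ ∈ parabolicGL b B := by
  rw [mem_parabolicGL_iff, liftOfCoboundary_apply, Units.val_mul, val_unitOfKer]
  exact (blockTriangular_one.add (hc σ).2.neg).mul (hsP _ (hρP σ))

include hs hsP hρP in
/-- The splitting cochain of a `P_b(B)`-valued lift is `𝔭_b(I)`-valued. [cite: Mazur1989Deforming, §1.7] -/
theorem splitting_mem_kerParabolic (ρ' : G →* GL n B) (hρ'P : ∀ σ, ρ' σ ∈ parabolicGL b B)
    (hρ' : ∀ σ, Matrix.GeneralLinearGroup.map φ (ρ' σ) = ρ σ) (σ : G) :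
    -(((ρ' σ * (s (ρ σ))⁻¹ : GL n B) : Matrix n n B) - 1) ∈ kerParabolic b φ := by
  refine neg_mem (val_sub_one_mem_kerParabolic b _
    (mul_mem (hρ'P σ) (inv_mem (hsP _ (hρP σ)))) ?_)
  rw [map_mul, map_inv, hρ', hs, mul_inv_cancel]

include hs hsP hρP in
/-- **Mazur's criterion for parabolic lifts** (cochain level).  For `φ : B ↠ A` with square-zero
kernel, a `P_b(A)`-valued `ρ : G → GL_n(A)` and a `P_b`-compatible section `s`: `ρ` lifts to a
`P_b(B)`-valued homomorphism iff its (`𝔭_b(I)`-valued) defect is the coboundary of a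
`𝔭_b(I)`-valued cochain; so the obstruction lies in `H²(G, 𝔭_b ⊗ I)`.
[cite: Mazur1989Deforming, §1.6 Prop. 2] [cite: Bockle2007Presentations, Theorem 2.2] -/
theorem exists_parabolic_lift_iff_exists_coboundary
    (hI : ∀ x ∈ RingHom.ker φ, ∀ y ∈ RingHom.ker φ, x * y = 0) :
    (∃ ρ' : G →* GL n B, (∀ σ, ρ' σ ∈ parabolicGL b B) ∧
        ∀ σ, Matrix.GeneralLinearGroup.map φ (ρ' σ) = ρ σ) ↔
      ∃ c : G → Matrix n n B, (∀ σ, c σ ∈ kerParabolic b φ) ∧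
        ∀ σ τ, liftDefect s ρ σ τ =
          (s (ρ σ) : Matrix n n B) * c τ * ((s (ρ σ))⁻¹ : GL n B) - c (σ * τ) + c σ := by
  constructor
  · rintro ⟨ρ', hρ'P, hρ'⟩
    obtain ⟨-, hcob⟩ := liftDefect_eq_of_lift hs hI ρ ρ' hρ'
    exact ⟨_, splitting_mem_kerParabolic b hs hsP ρ hρP ρ' hρ'P hρ', hcob⟩
  · rintro ⟨c, hc, hcob⟩
    exact ⟨liftOfCoboundary hs hI ρ c (fun σ => (hc σ).1) hcob,
      liftOfCoboundary_mem_parabolicGL b hs hsP ρ hρP hI c hc hcob,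
      map_liftOfCoboundary hs hI ρ c _ hcob⟩

end Algebra

/-! ## 5. The parabolic obstruction class in continuous cohomology -/

section Continuous

variable {n : Type} [Fintype n] [DecidableEq n] {α : Type} [LinearOrder α] (b : n → α)
  {A B : Type v} [CommRing A] [CommRing B]
  [TopologicalSpace B] [DiscreteTopology B] {φ : B →+* A}
  (hI : ∀ x ∈ RingHom.ker φ, ∀ y ∈ RingHom.ker φ, x * y = 0)
  {s : GL n A → GL n B} (hs : ∀ g, Matrix.GeneralLinearGroup.map φ (s g) = g)
  (hsP : ∀ g ∈ parabolicGL b A, s g ∈ parabolicGL b B)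
  {G : Type v} [Group G] [TopologicalSpace G] [IsTopologicalGroup G]
  (ρ : G →* GL n A) (hρP : ∀ σ, ρ σ ∈ parabolicGL b A)
  (hρ : IsOpen ((ρ.ker : Subgroup G) : Set G))

omit [TopologicalSpace B] [DiscreteTopology B] [TopologicalSpace G] [IsTopologicalGroup G] in
include hsP hρP in
/-- Conjugation by `s(ρσ)` on `𝔭_b(I)`, as an additive endomorphism. [cite: Mazur1989Deforming, §1.7] -/
def conjKerParabolic (σ : G) : kerParabolic b φ →+ kerParabolic b φ where
  toFun X := ⟨(s (ρ σ) : Matrix n n B) * (X : Matrix n n B) * ((s (ρ σ))⁻¹ : GL n B),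
    conj_mem_kerParabolic b _ (hsP _ (hρP σ)) X.2⟩
  map_zero' := Subtype.ext (by simp)
  map_add' X Y := Subtype.ext (by
    change (s (ρ σ) : Matrix n n B) * ((X : Matrix n n B) + Y) * ((s (ρ σ))⁻¹ : GL n B) =
      (s (ρ σ) : Matrix n n B) * (X : Matrix n n B) * ((s (ρ σ))⁻¹ : GL n B) +
        (s (ρ σ) : Matrix n n B) * (Y : Matrix n n B) * ((s (ρ σ))⁻¹ : GL n B)
    rw [mul_add, add_mul])

omit [TopologicalSpace B] [DiscreteTopology B] [TopologicalSpace G] [IsTopologicalGroup G] in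
/-- Unfolding `conjKerParabolic`. [folklore] -/
@[simp] theorem coe_conjKerParabolic_apply (σ : G) (X : kerParabolic b φ) :
    ((conjKerParabolic b hsP ρ hρP σ X : kerParabolic b φ) : Matrix n n B) =
      (s (ρ σ) : Matrix n n B) * (X : Matrix n n B) * ((s (ρ σ))⁻¹ : GL n B) :=
  rfl

omit [TopologicalSpace B] [DiscreteTopology B] [TopologicalSpace G] [IsTopologicalGroup G] in
include hI hs in
/-- The conjugation action of `G` on `𝔭_b(I)` through `ρ` is a representation.
[cite: Mazur1989Deforming, §1.7] -/
def adKerParabolicRepresentation : Representation ℤ G (kerParabolic b φ) where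
  toFun σ := (conjKerParabolic b hsP ρ hρP σ).toIntLinearMap
  map_one' := by
    refine LinearMap.ext fun X => Subtype.ext ?_
    change (s (ρ 1) : Matrix n n B) * (X : Matrix n n B) * ((s (ρ 1))⁻¹ : GL n B) =
      (X : Matrix n n B)
    rw [map_one]
    exact conj_eq_self_of_map_eq_one hI (s 1) (hs 1) X.2.1
  map_mul' σ τ := by
    refine LinearMap.ext fun X => Subtype.ext ?_
    change (s (ρ (σ * τ)) : Matrix n n B) * (X : Matrix n n B) * ((s (ρ (σ * τ)))⁻¹ : GL n B) =
      (s (ρ σ) : Matrix n n B) * ((s (ρ τ) : Matrix n n B) * (X : Matrix n n B) *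
        ((s (ρ τ))⁻¹ : GL n B)) * ((s (ρ σ))⁻¹ : GL n B)
    have h := conj_eq_of_map_eq hI (s (ρ (σ * τ))) (s (ρ σ) * s (ρ τ))
      (by rw [hs, map_mul ρ, _root_.map_mul (Matrix.GeneralLinearGroup.map φ) (s (ρ σ)), hs, hs])
      X.2.1
    rw [h, _root_.mul_inv_rev, Units.val_mul, Units.val_mul]
    noncomm_ring

include hI hs in
/-- **`𝔭_b ⊗ I` as a continuous representation** of `G` on the discrete module `𝔭_b(I)`.
[cite: Mazur1989Deforming, §1.7] -/
def adKerParabolicRep : ContinuousRep G ℤ (kerParabolic b φ) :=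
  ContinuousRep.ofStabilizerMemNhdsOne (adKerParabolicRepresentation b hI hs hsP ρ hρP) fun X => by
    refine Filter.mem_of_superset (hρ.mem_nhds (by simp)) fun σ hσ => ?_
    rw [SetLike.mem_coe, MonoidHom.mem_ker] at hσ
    refine Subtype.ext ?_
    change (s (ρ σ) : Matrix n n B) * (X : Matrix n n B) * ((s (ρ σ))⁻¹ : GL n B) =
      (X : Matrix n n B)
    rw [hσ]
    exact conj_eq_self_of_map_eq_one hI (s 1) (hs 1) X.2.1

/-- Unfolding the action of `adKerParabolicRep`. [folklore] -/
@[simp] theorem coe_adKerParabolicRep_apply (σ : G) (X : kerParabolic b φ) :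
    ((adKerParabolicRep b hI hs hsP ρ hρP hρ σ X : kerParabolic b φ) : Matrix n n B) =
      (s (ρ σ) : Matrix n n B) * (X : Matrix n n B) * ((s (ρ σ))⁻¹ : GL n B) :=
  rfl

/-- Unfolding the action of the `TopRep` of `adKerParabolicRep`. [folklore] -/
@[simp] theorem toTopRep_ρ_adKerParabolicRep_apply (σ : G) (X : kerParabolic b φ) :
    (((adKerParabolicRep b hI hs hsP ρ hρP hρ).toTopRep.ρ σ X : kerParabolic b φ) :
        Matrix n n B) =
      (s (ρ σ) : Matrix n n B) * (X : Matrix n n B) * ((s (ρ σ))⁻¹ : GL n B) :=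
  rfl

/-- **The parabolic obstruction cocycle**: the defect as a continuous inhomogeneous `2`-cocycle
with values in `𝔭_b(I)`. [cite: Mazur1989Deforming, §1.6 Prop. 2] -/
def parabolicDefectCocycle : contTwoCocycles (adKerParabolicRep b hI hs hsP ρ hρP hρ).toTopRep :=
  ⟨⟨fun p => ⟨liftDefect s ρ p.1 p.2, liftDefect_mem_kerParabolic b hs hsP ρ hρP p.1 p.2⟩,
    (IsLocallyConstant.desc _ Subtype.val (isLocallyConstant_liftDefect ρ hρ)
      Subtype.val_injective).continuous⟩,
    fun σ τ υ => Subtype.ext (by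
      change (s (ρ σ) : Matrix n n B) * liftDefect s ρ τ υ * ((s (ρ σ))⁻¹ : GL n B) +
          liftDefect s ρ σ (τ * υ) =
        liftDefect s ρ (σ * τ) υ + liftDefect s ρ σ τ
      exact liftDefect_cocycle hs hI ρ σ τ υ)⟩

/-- Unfolding `parabolicDefectCocycle`. [folklore] -/
@[simp] theorem coe_parabolicDefectCocycle_apply (σ τ : G) :
    (((parabolicDefectCocycle b hI hs hsP ρ hρP hρ).1 (σ, τ) : kerParabolic b φ) :
        Matrix n n B) = liftDefect s ρ σ τ :=
  rfl

variable [LocallyCompactSpace G]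

/-- **The parabolic obstruction class** `o_b(ρ) ∈ H²_cont(G, 𝔭_b ⊗ I)`.
[cite: Mazur1989Deforming, §1.6 Prop. 2] [cite: Bockle2007Presentations, Theorem 2.2] -/
def parabolicObstructionClass :
    continuousCohomology 2 (adKerParabolicRep b hI hs hsP ρ hρP hρ).toTopRep :=
  twoCocycleClass _ (parabolicDefectCocycle b hI hs hsP ρ hρP hρ)

/-- **Mazur's criterion for parabolic lifts, continuous form.**  For a locally compact
topological group `G`, a `P_b(A)`-valued `ρ : G → GL_n(A)` with open kernel and `φ : B ↠ A` with
square-zero kernel (`B` discrete): `o_b(ρ) = 0` in `H²_cont(G, 𝔭_b ⊗ I)` iff `ρ` lifts to a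
`P_b(B)`-valued homomorphism `ρ̃ : G → GL_n(B)` with open kernel.
[cite: Mazur1989Deforming, §1.6 Prop. 2] [cite: Bockle2007Presentations, Theorem 2.2] -/
theorem parabolicObstructionClass_eq_zero_iff :
    parabolicObstructionClass b hI hs hsP ρ hρP hρ = 0 ↔
      ∃ ρ' : G →* GL n B, IsOpen ((ρ'.ker : Subgroup G) : Set G) ∧
        (∀ σ, ρ' σ ∈ parabolicGL b B) ∧
        ∀ σ, Matrix.GeneralLinearGroup.map φ (ρ' σ) = ρ σ := by
  unfold parabolicObstructionClass
  rw [twoCocycleClass_eq_zero_iff]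
  constructor
  · rintro ⟨c, hc⟩
    have hc' : ∀ σ τ, liftDefect s ρ σ τ =
        (s (ρ σ) : Matrix n n B) * (c τ : Matrix n n B) * ((s (ρ σ))⁻¹ : GL n B) -
          (c (σ * τ) : Matrix n n B) + (c σ : Matrix n n B) := fun σ τ =>
      congrArg (fun X : kerParabolic b φ => (X : Matrix n n B)) (hc σ τ)
    refine ⟨liftOfCoboundary hs hI ρ (fun σ => (c σ : Matrix n n B)) (fun σ => (c σ).2.1) hc',
      ?_, liftOfCoboundary_mem_parabolicGL b hs hsP ρ hρP hI _ (fun σ => (c σ).2) hc',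
      map_liftOfCoboundary hs hI ρ _ _ hc'⟩
    -- open kernel: it contains `ker ρ ∩ {c = c 1}`, a neighbourhood of `1`
    refine Subgroup.isOpen_of_mem_nhds _ (g := 1) ?_
    have hU : ({σ : G | ρ σ = 1} ∩ {σ | c σ = c 1}) ∈ 𝓝 (1 : G) := by
      refine Filter.inter_mem (hρ.mem_nhds (by simp)) ?_
      exact ((isOpen_discrete {c 1}).preimage c.continuous).mem_nhds rfl
    refine Filter.mem_of_superset hU ?_
    rintro σ ⟨hσ1, hσ2⟩
    rw [Set.mem_setOf_eq] at hσ1 hσ2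
    have key : liftOfCoboundary hs hI ρ _ (fun σ => (c σ).2.1) hc' σ =
        liftOfCoboundary hs hI ρ _ (fun σ => (c σ).2.1) hc' 1 := by
      rw [liftOfCoboundary_apply, liftOfCoboundary_apply]
      have e1 : unitOfKer hI (-(c σ : Matrix n n B)) (neg_mem (c σ).2.1) =
          unitOfKer hI (-(c 1 : Matrix n n B)) (neg_mem (c 1).2.1) :=
        Units.ext (by simp [hσ2])
      rw [e1, hσ1, ρ.map_one]
    rw [SetLike.mem_coe, MonoidHom.mem_ker, key, MonoidHom.map_one]
  · rintro ⟨ρ', hρ'open, hρ'P, hρ'⟩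
    obtain ⟨-, hcob⟩ := liftDefect_eq_of_lift hs hI ρ ρ' hρ'
    have hmem := splitting_mem_kerParabolic b hs hsP ρ hρP ρ' hρ'P hρ'
    have hlc : IsLocallyConstant fun σ : G =>
        -(((ρ' σ * (s (ρ σ))⁻¹ : GL n B) : Matrix n n B) - 1) := by
      have h1 : IsLocallyConstant fun σ : G => (ρ' σ, ρ σ) :=
        (isLocallyConstant_of_isOpen_ker' ρ' hρ'open).prodMk
          (isLocallyConstant_of_isOpen_ker' ρ hρ)
      exact h1.comp fun q : GL n B × GL n A => -(((q.1 * (s q.2)⁻¹ : GL n B) : Matrix n n B) - 1)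
    refine ⟨⟨fun σ => ⟨-(((ρ' σ * (s (ρ σ))⁻¹ : GL n B) : Matrix n n B) - 1), hmem σ⟩,
      (IsLocallyConstant.desc _ Subtype.val hlc Subtype.val_injective).continuous⟩,
      fun σ τ => Subtype.ext ?_⟩
    exact hcob σ τ

end Continuous

end LiftingObstruction

end Literature.NumberTheory.GaloisRepresentations
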